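import Literature.NumberTheory.EllipticCurves.Rank1Residual.Typed.X11Three
import Literature.NumberTheory.EllipticCurves.Rank1Residual.X11
import Literature.NumberTheory.EllipticCurves.SkinnerZhang2014.MultiplicativeIndivisibility
import Literature.NumberTheory.EllipticCurves.Castella2018.MultiplicativePPartErratum
import HarnessLib

/-!
# Class X11 at `p ≥ 5` (multiplicative `p`, irreducible `E[p]`) — TYPED residue: exactly what is missing after the published and the announced statements (cell `b2b-bsdres`)

HONEST FRAMING (run/shared/lean/b2b/bsd-rank1-residual/, verbatim): the goal of the cell is to
DELETE the COMBINATION-SHAPED residual classes for ALL analytic-rank `≤ 1` elliptic curves over `ℚ`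
— "full BSD formula for every rank `≤ 1` curve in class C" assembled STRICTLY from published
theorems — so that the rank-`≤ 1` remainder becomes exactly the CONSTRUCTION-SHAPED classes, which
are TYPED (missing-input `Prop`s), NOT attempted. This is not "finishing BSD". An announced /
unrefereed statement enters only as an explicitly labelled OPEN hypothesis (`…_OPEN` binders); a
theorem taking one is CONDITIONAL and deletes nothing.

**The class.** X11 (RESIDUAL-CASES.md §a.2 v3; `Rank1Residual.ClassX11 W p :=
Mult W p ∧ Irr W p ∧ (¬ Ram W p ∨ (r = 1 ∧ ¬ Semistable W) ∨ (r = 1 ∧ p = 3))`). This file is the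
general-`p` companion of `Typed/X11Three.lean` (prover x11b, the clause `p = 3`) written for the
primes `p ≥ 5`, where the class reads `mult(p) ∧ irr(p) ∧ (¬ram(p) ∨ (r = 1 ∧ ¬sst))`. Referee
rulings (REFEREE.md): C3/R6.3 — at `p ≥ 5` the sub-classes `N_E < 5000` (Miller 2011) and
`r = 0 ∧ surj(p) ∧ ord_p #Ш_an = 0` (Wuthrich 2014 Prop. 21) are CLOSED from print
(`Rank1Residual/X11.lean`, prover x11a); the part `r = 1 ∧ ram(p)` is reached ONLY by announced
statements (Castella's erratum Thm. A′ ⇐ Fouquet–Wan; Skinner–Zhang 2014), each on the sub-locus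
of its own side conditions; the part `¬ram(p)` (both ranks) is reached by NOTHING, published or
announced, and is RECOMMENDED construction-shaped (pub-bsdpct referee G24: the rank-one part of X11
at every multiplicative `p` construction-shaped).

**What this file adds (definitions + bookkeeping theorems; explicit binders; nothing asserted).**
The TYPE of the missing input at a pair `(E, p)` of X11, in the cell's common currency
(`Typed/Basic.lean`: `MissingPPartAt` = Miller's last clause "`#Ш_an` is a rational of valuation
`ord_p #Ш`", and its halves `MissingLowerBoundAt` / `MissingUpperBoundAt`), and the kernel-checked
statement of WHERE an input is still needed once every published theorem and every announced
statement has been spent (`X11.bsdp_of_typedResidue_of_five_le`):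
* rank `0` (so `¬ram(p)`): `X11RankZero.MissingInputAt W p` — with `ρ̄_{E,p}` surjective the upper
  bound `ord_p #Ш ≤ ord_p #Ш_an` is IN PRINT (Wuthrich, Doc. Math. 19 (2014) Prop. 21;
  `Typed.missingUpperBoundAt_of_wuthrich`), so the missing input is the LOWER bound
  `ord_p #Ш_an ≤ ord_p #Ш` (the Eisenstein-congruence / main-conjecture direction, i.e. a
  (ram)-FREE integral cyclotomic main conjecture at `p ‖ N`); without surjectivity (irreducible
  proper image; Wuthrich's constant `C` may contain `p`) it is the whole output. It is needed
  exactly at the rank-`0` pairs with `N_E ≥ 5000` and (`ρ̄` not surjective or `p ∣ #Ш_an`); on the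
  published sub-class it holds trivially (`X11RankZero.missingInputAt_of_surj_of_shaAn_unit`).
  The `p = 3` instance is x11b's `X11ThreeRankZero.MissingInputAt` (`…_three_iff`, `Iff.rfl`).
* rank `1`: the whole output `MissingPPartAt W p`. At `p ≥ 5` it is SUPPLIED — conditionally, by
  the two announced binders — on the A′-locus (`X11.AprimeLocusAt`, x11b: a NONSPLIT multiplicative
  `q ≠ p` with `p ∤ v_q(Δ_min)` and `E(ℚ_p)[p] = 0`; `X11.missingPPartAt_of_aprimeLocusAt_OPEN`) and
  on the Skinner–Zhang locus (`SkinnerZhang2014.Hypotheses W p`, (a)–(e) of arXiv:1407.1099 Thm.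
  1.1; `X11.missingPPartAt_of_skinnerZhang_OPEN`), and by NOTHING off both loci — in particular on
  all of `¬ram(p)` (`X11.not_announcedLoci_of_not_ram`). Needed exactly at the rank-`1` pairs with
  `N_E ≥ 5000` off the two loci.
* `X11.MissingInputAt W p` (both ranks) with the canonical conditional class theorem
  `X11.bsdp_of_missingInputAt : r_an ≤ 1 → ClassX11 W p → X11.MissingInputAt W p → BSD(E,p)` (odd
  `p`), and the PUBLISHED-ONLY residue theorem `X11.bsdp_of_typedResidue` (no OPEN binder: the
  inputs are needed at `N_E ≥ 5000 ∧ (r = 1 ∨ ¬surj ∨ p ∣ #Ш_an)`).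
* (gen 3; REFEREE R8.1, flag `CAS18-ERR-ram2`) the announced A′ argument read AS PRINTED: the
  binder is invoked only on x11b's sub-locus `X11.AprimeRam2LocusAt` (a second ramified
  multiplicative prime `ℓ ∉ {p, q}`) — `X11.missingPPartAt_of_aprimeRam2LocusAt_OPEN`,
  `X11.skinnerZhang_two_ramified_of_aprimeRam2LocusAt` (there Skinner–Zhang's (e) holds), and the
  residue theorem `X11.bsdp_of_typedResidue_of_five_le_asPrinted`.
The universally quantified statements "for every pair of the class, the missing input" are OPEN
PROBLEMS, not Literature statements (nothing proves or announces them); they live in CLASSES.md.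

**Closest published / announced results at a multiplicative `p ≥ 5`, verbatim, and why they stop
short** (audit of prover x11a, `b2b-bsdres-x11a/REPORT.md`; this seat re-read the two announced
engines, 2026-08-18):
* Skinner, Pacific J. Math. 283 (2016) Thm. C (rank `0`, `p ≥ 3` good ordinary or multiplicative,
  in print): hypothesis "(ii) there exists a prime `q ≠ p` such that `q ‖ N` and `ρ̄_{E,p}` is
  ramified at `q`" = `Ram W p` — the rank-`0` part of X11 is `¬ram(p)` by definition. His §2.5
  explains the role of (ii): it produces `τ ∈ I_q ⊂ Gal(ℚ̄/ℚ[μ_{p^∞}])` with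
  `T/(ρ(τ) − 1)T` free of rank one, the integrality hypothesis of Kato, Astérisque 295 Thm. 13.4 (3)
  and of Skinner–Urban 2014 Thm. 3.6.4 (iii).
* Burungale–Castella–Skinner, IMRN 2025 = arXiv:2405.00270v2 — the only PUBLISHED removal of the
  auxiliary prime — Thm. 1.1.2 (p. 2): "`p` a prime of good ordinary reduction for `E`"; Cor. 1.3.1
  (p. 4): "Let `p > 3` be a prime of good ordinary reduction"; engine Thm. 3.2.1 (Wan; p. 7):
  "`p > 3` … good ordinary". Nothing at `p ‖ N` (`ClassX11.not_good`).
* Fouquet–Wan, *The Iwasawa Main Conjecture for modular motives*, arXiv:2107.13726v3 (2022;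
  UNREFEREED) — the engine behind Castella's erratum. Thm. 1.1 (p. 1; = Thm. 1.7, Cor. 1.10 =
  `p`-part of BSD in rank `0` "with arbitrary ramification at `p`"): hypotheses "(Langlands) the
  semisimplification of `ρ̄|G_{ℚ_p}` is equal neither to `χ̄ ⊕ χ̄` nor to `χ̄ ⊕ χ̄_cyc χ̄`" and
  "(Steinberg) there exists `ℓ ∤ p` such that `ℓ ‖ N` and such that `dim ρ̄^{I_ℓ} = 1` and
  `dim ρ̄^{G_ℓ} = 0`". (Steinberg) is an auxiliary ramified multiplicative prime `ℓ ≠ p` (⇒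
  `ram(p)`); and for a weight-2 form Steinberg AT `p` (every X11 pair: `p ‖ N`) the
  semisimplification of `ρ̄|G_{ℚ_p}` is `μ χ̄_cyc ⊕ μ` (`μ` unramified quadratic; Tate curve), which
  IS of the excluded shape `χ̄ ⊕ χ̄_cyc χ̄` — so Thm. 1.1/Cor. 1.10 reach NO X11 pair at its own `p`.
  Its Thm. 4.41 (two-variable Greenberg main conjecture over an imaginary quadratic `K`, one
  divisibility): "`ρ_f|G_{ℚ_p}` is a crystalline representation … There exists `q ‖ N` (in
  particular `q ∤ p`) which is not split in `K` … if `ℓ ∣ N` is not split in `K`, then `ℓ` is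
  ramified in `K` and `π(f)_ℓ` is a special Steinberg representation twisted by [the unramified
  character `ℓ ↦ (−1)ℓ^{k/2−1}`]" — enters X11 only through Castella's Hida-family descent
  (erratum Thm. 1.1/A′), whence A′'s NONSPLIT ramified `q`: again `ram(p)`.
* Castella, Erratum to Camb. J. Math. 6 (2018) (web, n.d.; unrefereed), Thm. A′: "multiplicative
  reduction at `p > 3` … `E[p]` is irreducible …, `E` has nonsplit multiplicative reduction at some
  prime `q ≠ p` where `E[p]` is ramified, and `E(ℚ_p)[p] = 0`. If `ord_{s=1} L(E,s) = 1`, then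
  `ord_p(L'(E,1)/(Reg(E/ℚ)·Ω_E)) = ord_p(#Ш(E/ℚ) ∏_{ℓ∣N} c_ℓ(E/ℚ))`" — binder
  `Castella2018.erratum_thmAprime_padicVal_bsd_rankOne_OPEN`. (The printed Thm. A — semistable,
  `ram` — is WITHDRAWN at `p ‖ N` by this erratum: REFEREE R6.3.)
* Skinner–Zhang, arXiv:1407.1099v1 (2014; unrefereed) Thm. 1.2: "`p ≥ 5` … hypotheses (a)–(e)",
  (e) "at least two prime factors `ℓ ‖ N` such that `p ∤ ord_ℓ(Δ)`" (⇒ `ram(p)`,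
  `SkinnerZhang2014.Hypotheses.exists_ramified_ne`) — binder
  `SkinnerZhang2014.thm1_2_padicVal_bsd_rankOne_OPEN`.
* Good-reduction theorems, all void on X11 (`ClassX11.not_good`): W. Zhang, Camb. J. Math. 2
  (2014) p. 193 "`p ∤ N`"; Burungale–Skinner–Tian–Wan arXiv:2409.01350 Thm. 1.9 "`p ∤ 2N` an
  ordinary prime … (ram)"; Jetchev–Skinner–Wan 2017 Thm. 1.2.1 "`p ∤ N`"; Yan–Zhu, J. Algebra
  (2026) Thm. 4.15 "good ordinary".

**Census** (RESIDUAL-CASES v3, `N < 10⁴`, X11 ∧ `p ≥ 5`: 93 pairs = 32 @5 + 7 @7 + 54 @≥11;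
`b2b-bsdres-x11a/REPORT.md` §3, job j039928 of x11b; numbers the writer's and the provers', lane to
certify): rank `0`: 83 pairs, ALL with `ρ̄` surjective and `p ∤ #Ш_an` ⇒ all inside the published
sub-class (the typed rank-`0` input is needed at NO census pair below `10⁴`; it is the class-level
residue); rank `1`: 10 pairs, all with `#Ш_an = 1` — 5 in print by Miller (`N < 5000`: 2760k1,
3060h1, 3465d1, 4230bg1, 4590o1 @5) and 5 open: `5824c1@7, 6240be1@5, 7110m1@5, 8670u1@5,
9954j1@7`. Of the open ones: on the A′-locus AS ANNOUNCED 2 (5824c1@7, 7110m1@5); on the A′ ∧ (ram2)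
sub-locus — where the announced argument closes AS PRINTED (REFEREE R8.1, flag `CAS18-ERR-ram2`:
Castella 2018 §5 / the erratum's "same argument" takes the rank-`0` input for the twist `E^D` from
Skinner 2016 Thm. C (ii), which needs a SECOND ramified multiplicative prime `ℓ ∉ {p, q}`; x11b's
`X11.AprimeRam2LocusAt`) — 1 (7110m1@5: `q = 2`, `ℓ = 79`, both nonsplit with `5 ∤ v`); on the
Skinner–Zhang locus 1 (7110m1@5: split multiplicative at `5` with `v_5(Δ_min) = 1` and
`ord_5(log_5 q_E) = 1` — gen-3 numerics, two engines agreeing: exact `q`-series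
`u = q_E/5 ≡ 13`, `u⁴ ≡ 11 ≢ 1 (mod 25)` (`numerics/sz_b_log_check.py`) and PARI's Tate
parametrisation, cell job j041184 (`log_5 u = 3·5 + 3·5² + 2·5³ + O(5⁶)`); (d): `79 ≡ −1 (mod 5)`
with `5 ∤ v_79(Δ_min) = 2`; (e): `{2, 79}`; at the other 9 rank-one pairs (b) fails since
`p ∣ v_p(Δ_min)`, except 8670u1, where (e) fails); reached by nothing, published or announced, AS
PRINTED: 4 (5824c1@7 — A′ as announced only: its one ramified multiplicative prime `13` leaves no
(ram2) witness —; 6240be1@5, 9954j1@7: every ramified multiplicative prime SPLIT and (b) fails;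
8670u1@5: `¬ram`). So "announced-reachable" in the sense of R8.1 means exactly 7110m1@5 (by A′ ∧
(ram2) AND by Skinner–Zhang). Independently of all this, each of the 5 open pairs has `p ∤ #Ш_an`,
so each is closed by PUBLISHED theorems plus ONE per-curve certificate `Ш(E/ℚ)[p] = 0`
(`Typed/KolyvaginCertificate.lean`: Kolyvagin's index certificate `p ∤ [E(K) : ℤ y_K]` — possible
only where `p ∤ ∏_q c_q`, i.e. at 5824c1@7 and 7110m1@5 —, a `p`-descent, or Kim's Kurihara
numbers, RESIDUAL-CASES lever L5).

**Census addendum (gen 4, 2026-08-18; lane collector 19:14:57Z = RESIDUAL-CASES v5, COMPLETE for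
`N < 2·10⁴`; `b2b-bsdres-x11a/REPORT-g4.md` H1–H2; numbers this seat's from the lane files
`bsdN/RESIDUE.jsonl` / `out/full.jsonl`, lane/writer to certify).** The v3 paragraph above is
SUPERSEDED in its counts. X11-type pairs at `p ≥ 5` (`mult ∧ irr`), `N < 2·10⁴`: rank `0`: 615
(`N < 10⁴`: 188), all `¬ram` and all with `ρ̄` surjective, 613 with `p ∤ #Ш_an` (inside the published
sub-class, Wuthrich Prop. 21) and 2 with `#Ш_an = 25` at `p = 5` (10580l1, 17640l1: the rank-`0`
typed input = a LOWER bound, x11b's `Typed/CasselsLowerBound.lean` with a certificate `Ш(E)[5] ≠ 0`);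
rank `1`: 85 (`N < 10⁴`: 15 — the 5 Miller-covered ones below 5000 and TEN open with
`5000 ≤ N < 10⁴`: 6240be1@5, 6390k1@5, 6390p1@5, 6960r1@5, 7560e1@5, 8085y1@5, 8670u1@5,
8946p1@7, 9090n1@5, 9954j1@7), all non-semistable, all with `ρ̄_{E,p}` surjective and `#Ш_an = 1`;
by type split∧ram 48, nonsplit∧ram 26, nonsplit∧¬ram 6, split∧¬ram 5. **7110m1@5 and 5824c1@7 of
the list above are CLOSED on this collector by the lane's Kolyvagin certificate** (`bsd_full`,
T-KOLY: `I_K` at `D = −359`, `m = 24`, `5 ∤ m`, job j039196; at `D = −103`, `m = 72`, `7 ∤ m`,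
j039195 — the Heegner fields gen 3 predicted), kernel form `X11.bsdp_of_kolyvagin_of_not_dvd_index`
(`Typed/KolyvaginCertificate.lean`). Besides the 85, the 56 semistable `T-CAS` records (rank `1`,
`p ‖ N`, irr, ram; `bsd_full` in the lane file through Castella 2018 Thm A, withdrawn at `p ∣ N` by
the author's erratum; referee A G25/G33: class-residue X11b) make 141 rank-one X11-type pairs at
`p ≥ 5` not closed by a published theorem. THE DECIDING INVARIANT is `ord_p ∏_q c_q` (Gross–Zagier
V (2.2): granted the BSD shape over the Heegner field, `ord_p [E(K) : ℤ y_K] = ord_p ∏ c_q +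
½ ord_p #Ш(E/K)`; the lane's indices confirm it at odd parts on every record checked): at the 50
pairs with `p ∤ ∏ c_q` (43 residue + 7 T-CAS) Kolyvagin's PUBLISHED bound certifies at the first
Heegner field with `p ∤ #Ш_an(E^D)` (where-to-look list: REPORT-g4.md H5, cell jobs j042087
(43/43 residue pairs have ≥ 3 such fields among the first 8 Heegner discriminants) and
j042099/j042317 (7/7 T-CAS pairs); the prediction `½·ord_p #Ш_an(E^D)` reproduces the lane's
certified `ord_p m` at every field the lane tried, 51/51; the tried fields all had
`p ∣ #Ш_an(E^D)` — a selection effect, not an obstruction); at the 91 pairs with `p ∣ ∏ c_q` (42 residue: 32 ram, 10 ¬ram; 49 T-CAS) NO Heegner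
field can work, Jetchev's sharpening is printed under `p ∤ N` only (referee A G28), and Kim's
Kurihara-number formula needs the Tamagawa defect `∂^{(∞)} = Σ ord_p c_ℓ` (Amer. J. Math. 2026,
Conj. 1.10, open) — the one printed route there is Kato/IMC divisibility + Jones's leading term +
a per-curve `p`-adic computation (Miller 2011 Prop. 7.6, the curve 1155k @ 7), whose algebra is the
tree's `Typed/PAdicCertificateEngine.lean` (p179575) and whose class-level inputs at `p ‖ N` are:
Skinner, Pacific J. Math. 283 (2016) Thm. A on the (ram) locus (PUBLISHED; tree, gen 5:
`Skinner2016.thmA_charIdeal_multiplicative` p181012 — Thm. A for `f = f_E` at `p ‖ N` in the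
classical-Selmer form Skinner prints in his §3.2, `Ch' = (𝓛_f')` at a split / `(𝓛_f)` at a non-split
`p` —, composed with the engine for all 130 (ram) pairs, semistable or not, in
`Typed/PAdicCertificateMultiplicative.lean` p181066, where the engine's input `T^{rank} ∣ f_E` is
PROVED for every prime from `mordellWeilRank_le_coinvariantsRank`), Wuthrich 2014 Cor. 19 for semistable `E` (tree:
`Wuthrich2014.corollary19_splitMultiplicative` p179618, `corollary19_nonsplitMultiplicative`
p179776; composed with the engine in `Typed/PAdicCertificateSemistable.lean` p179945; the engine is
unit-tested at reducible good ordinary `p` in `Typed/PAdicCertificateReducible.lean` p180012),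
NOTHING verbatim for non-semistable `¬ram` curves (11 pairs; Kato Thm. 17.4 is printed for good
ordinary `p`; the `p ‖ N` divisibility is only ATTRIBUTED to Kato in print — Wuthrich 2014 §1,
Emerton–Pollack–Weston 2006 Thm. 5.1.2, Miller 2011 Prop. 7.6) — SUPERSEDED 2026-08-19 (gen 6):
the attribution is now the tree fact `Wuthrich2014.kato_charIdeal_dvd_multiplicative_of_surjective`
(p181258, literature seat; referee F35, PUB with flag `Wu14-surj-attribution`: Wuthrich 2014 Thm. 3 +
p. 382 and the first case of the proof of Cor. 19 — surjective `ρ_{E,p^∞}`, NO semistability, NO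
(ram)), composed with the engine in `Typed/PAdicCertificateSurjective.lean` (p181404, gen 6); all 85
residue pairs have `ρ̄_{E,p}` surjective, so the 11 join the other 130 in the shape "printed
divisibility + Jones clause + certificate"; a numbered theorem WITH PROOF of this divisibility for
non-semistable `E` exists in print up to an inexplicit finite set of primes per curve — Rubin,
*Euler systems and modular elliptic curves*, LMS LN 254 (1998) Thm. 8.7, hypothesis
`p ∤ r_E ∏_{q ∣ N, q ≠ p} ℓ_q(q^{-1})` with Kato's preprint constant `r_E` — and inside Kato's
coarse Thm. 12.5 (3)(4) (Astérisque 295: the exceptional prime (12.5.1) is the augmentation ideal of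
the split case); see `b2b-bsdres-x11a/REPORT-g6.md` H2 —, and J. W. Jones, Duke Math. J. 59
(1989) (not held, acq-07893; J. Nekovář, *Selmer complexes*, Astérisque 310 (2006), HELD since
gen 6 as `paper:url-b67cae7ac816`, prints the general formula of BSD type Thm. 11.7.11 for
Greenberg's local conditions at an ordinary = good ordinary OR multiplicative `p`, §0.10, §0.16.1 (ii),
from which the clause could be transcribed once his extended Selmer group / height / error terms are
identified with the tree's objects — REPORT-g6.md H3). Certificate VALUES (PARI 2.17 `ellpadicbsd`/`ellpadicregulator`,
jobs j042099/j042317/j042338; control 1155k@7 = Miller's printed computation, j041779): the `p`-adic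
analytic `Ш`, `S_p = Lp/Reg_p`, is a `p`-adic UNIT at all 141 pairs (`= 1 + O(p^k)` at 129,
`= 2 + O(p^k)` exactly at 12 pairs with `2⁴ ∣ N` — an engine normalisation under verification,
`ord_p` untouched). After gen 5 the ONLY class-level input of this route not in the tree, for the
130 (ram) pairs, is ONE clause of Jones 1989 (if `ord_{T=0} f_E = rank` then the `p`-adic regulator
is non-zero and `[T^r] f_E` has the BSD-shaped valuation; text not held, acq-07893; Stein–Wuthrich,
Math. Comp. 82 (2013), which restates it, not held either, acq-00030); for the 11 `¬sst ∧ ¬ram`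
pairs also the divisibility — since gen 6 (2026-08-19) the flagged fact F35 (p181258 ∘ p181404)
supplies it, so on all 141 pairs the one missing class-level input is the Jones clause. No verdict
or label is changed by this addendum.

**Census addendum #5 (gen 7, 2026-08-19) — the Jones clause is in the tree.** Stein–Wuthrich,
Math. Comp. 82 (2013) turned out to be HELD (`paper:url-055ad7d818a8`, the preprint `shark.pdf`; the
store record carries no title, which is why acq-00030 stayed open): its **Thm. 6.1 "(Schneider,
Perrin-Riou, Jones)"** (p. 20; `p > 2`, good ordinary OR multiplicative reduction, `f_E` the
characteristic series of the dual of the CLASSICAL Selmer group, "the multiplicative case is due to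
Jones [Jon89]", heights of §4.2) is now the pair of named facts
`SteinWuthrich2013.thm61_splitMultiplicative` / `thm61_nonsplitMultiplicative`
(`SteinWuthrich2013/MultiplicativeLeadingTerm.lean`, p181807, reviewed), stated in the vocabulary of
`Schneider1985_order_charGenerator` with SW's §4.2 `p`-adic height PINNED by explicit Tate-curve
formulas (Tate curve `E_q`; scale `C² = c₆(E_q)c₄(E)/(c₄(E_q)c₆(E))`; `log_p(u(P))² = log_E(P)²/C²`;
`σ_q(u)²` through `cosh(log_p u)`, so that the non-split case needs no quadratic extension; split
height `= (4.1) - log_p(u)²/log_p q_E`; predicates `IsSplitMultCanonical Dh Dq` / `IsMultCanonical Dh q`),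
and the hypothesis `hLT` of `Typed/PAdicCertificateMultiplicative.lean` /
`Typed/PAdicCertificateSurjective(Three).lean` is DISCHARGED in
`Typed/PAdicCertificateMultiplicativeCanonical.lean` (p181868: `X11.bsdp_of_thmA_{split,nonsplit}_of_canonical_certificate`,
`X11.bsdp_of_katoSurj_{split,nonsplit}_of_canonical_certificate`, `…_of_surjective_pow_…`,
`bsdp_of_thmA_…`). Hence on the 2026-08-18 collector ALL 141 rank-one `p ‖ N`, `p ≥ 5` pairs
(91 split / 50 non-split) are "PUBLISHED named facts (divisibility: Skinner Thm. A on 130 / F35,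
flagged, on 141 / Cor. 19 on 56; leading term: SW Thm. 6.1; GZK; Prop. 21; BDGP) + a per-curve
certificate about DEFINED quantities (`ord_{T=0} L_p = r + e`; the valuation of the normalised leading
coefficient of `L_p` against `𝓛_p · ∏ c_v · Reg_p(E, Dh)` resp. `2 · ∏ c_v · Reg_p(E, Dh)` for `Dh` THE
Stein–Wuthrich height; `p ∤ #Ш_an`)": NO class-level typed input remains on X11 ∧ `r = 1` ∧ `p ≥ 5`,
and what remains is CONSTRUCTION-shaped (the per-curve computation; VALUES in hand at 141/141 from the
gen-4 jobs, computed in exactly this normalisation). SW Thm. 7.3 (p. 22) is a second refereed numbered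
print of F35's statement. No verdict or label is changed by this addendum (the lane certifies);
`b2b-bsdres-x11a/REPORT-g7.md`.

**Census addendum #6 (gen 8, 2026-08-19) — what reaches `¬ram(p)`, precisely.** "`ρ̄` ramified at
`q`" is a property of `ρ̄ = E[p]`, shared by every member of the Hida family `H(ρ̄)`, while "`q ‖ N`" is
a property of the member (REFEREE R32.4); for elliptic-curve members at `p ≥ 5` the conjunction (ram)
is nevertheless a `ρ̄`-invariant (`b2b-bsdres-x11a/REPORT-g9.md` §5), so a `¬ram` curve has no (ram)
congruent elliptic curve; but Emerton–Pollack–Weston,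
Invent. Math. 163 (2006) Cor. 5.1.4 / Thm. 5.1.3 transport the cyclotomic main-conjecture identity
with `μ = 0` along `H(ρ̄)` — in particular TO `f_E` at `p ‖ N` (their Ex. 5.3.1 is `X₀(11)` at
`p = 11`) FROM any congruent partner where it is known — with no hypothesis at the auxiliary primes
(tree: `EmertonPollackWeston2006.cor514_transfer_of_{goodOrdinary,multiplicative}`, p182930, for an
ELLIPTIC-CURVE partner `E₁`; rank-`0` consumer WITHOUT numerics and with `p ∣ #Ш_an` allowed:
`Typed/MultiplicativeRankZero.lean`, p182962, and `Typed/X11HidaTransfer.lean`, p184005 (landed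
2026-08-19 after this addendum was first written; REFEREE R33.4) — where `X11RankZero.MissingInputAt`
is DISCHARGED by the transferred identity). A partner with a KNOWN
identity exists in print (Burungale–Castella–Skinner 2025 at a good ordinary prime ∘ Ribet's level
lowering) exactly when `E[p]` is finite at `p` ("peu ramifié": `p ∣ v_p(Δ_min)`), as the
level-lowered newform `g` of level `N/p` — a `GL₂`-type form (the tree has no Selmer/`L_p`
vocabulary for it) — and up to the per-curve certificate "`μ = 0`"; when `E[p]` is "très ramifié"
(`p ∤ v_p(Δ_min)`) every weight-two member of `H(ρ̄)` is Steinberg at `p` and NO (ram)-free source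
is in print: this is the genuinely missing published piece behind `X11RankZero.MissingInputAt`.
Census (`N < 2·10⁴`, X11-type `p ≥ 5`): rank `0` `¬ram` 615 = peu 16 / très 599 (613 closed by
Prop. 21); rank `1`: ram 74 (peu 33 / très 41), `¬ram` 11 (peu 2: 10890cc1@5, 13230dt1@5; très 9);
the TWO open rank-`0` pairs are très ramifié (10580l1@5: split, `v₅(Δ) = 1`; 17640l1@5: non-split,
`v₅(Δ) = 7`), so no transfer partner exists for them in print — but each has a RANK-TWO curve of
the SAME conductor congruent mod `5` (10580o1 `[0,0,0,23,529]`, Tam `24`; 17640m1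
`[0,0,0,-588,10388]`, Tam `96`; torsion trivial; congruence of all `a_n` verified through the
Sturm bound by the seat, one engine), the Cremona–Mazur visibility situation: certificate route
`X11RankZero.bsdp_of_casselsTate_of_dvd` (`Typed/X11RankZeroCertificate.lean`, p182866 — ONE element
of `Ш(E)[5]`); the visibility criterion at `p ∣ N` is the Cremona–Mazur appendix to Agashe–Stein,
Math. Comp. 74 (2005) (Agashe–Stein 2002 Thm. 3.1 needs `p ∤ N`). No verdict or label is changed by
this addendum (`b2b-bsdres-x11a/REPORT-g8.md`).

**Census addendum #7 (gen 9, 2026-08-19) — the two open rank-`0` pairs are closed by VISIBILITY, with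
the dimension count PROVED IN THE TREE at `p ∣ N`.** The visibility criterion is no longer awaited from
print: `WeierstrassCurve.exists_sha_ne_zero_of_congr_of_index_lt` (`CongruenceVisibility.lean`,
p184367) and `…_of_congr_of_rank` (`CongruenceVisibilityLocalFactors.lean`, p184399) prove, from the
tree's Galois-cohomology library and with NO named fact, that for an odd prime `p`, a `Γ_K`-isomorphism
`θ : E'[p] ≅ E[p]` and a finite set `S ⊇ bad(E) ∪ bad(E') ∪ {v ∣ p}`,
`[E(K):pE(K)] · ∏_{v ∈ S} #𝓛_v(E') < [E'(K):pE'(K)]` forces `Ш(E/K)[p] ≠ 0` (`𝓛_v(E')` the local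
Kummer condition, of order `#E'(K_v)[p] · #(𝓞_v/p)`; Agashe–Stein's hypothesis `p ∤ N` is replaced by
this count, so the multiplicative prime `p ‖ N` of an X11 pair is allowed), and the X11 consumer
`X11RankZero.bsdp_of_congr_of_rank_two` (`Typed/X11Visibility.lean`) turns it, with Prop. 21 +
Cassels–Tate + GZK + modularity (`X11RankZero.bsdp_of_casselsTate_of_dvd`), into `BSD(E,p)` from a
`p`-congruent partner of rank `≥ 2` with `E'(ℚ_v)[p] = 0` on `S`. Certificates (two engines: gen-8
pure-Python Sturm check + PARI/GP job j051216 of gen 9, `b2b-bsdres-x11a/REPORT-g9.md` §3):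
`10580l1 ~ 10580o1` and `17640l1 ~ 17640m1` are congruent mod `5` through the Sturm bound (all
`n ≤ 3313`, resp. `8065`; `E[5]`, `E'[5]` irreducible, indeed `ρ̄` surjective at every `ℓ` for all four
curves by the Cremona–Sutherland image data), `rank E'(ℚ) = 2` (Cremona; PARI `ellrank` `[2,2]`) and
`[E'(ℚ):5E'(ℚ)] ≥ 25` exactly (two reduction functionals, determinants `≢ 0 mod 5`), and
`E'(ℚ_v)[5] = 0` for `v ∈ S = {2,5,23}` resp. `{2,3,5,7}` (no `ℚ_v`-root of `ψ₅`; independently: `E'`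
additive at `v ≠ 5` with `5 ∤ c_v · #Ẽ'_ns(𝔽_v)`, and `5 ∤ c₅ · #Ẽ'_ns(𝔽₅) = 4·4` resp. `2·6`), so
`[E:5E] · ∏ #𝓛_v(E') = 1 · 5 < 25 ≤ [E':5E']`: `Ш(E)[5] ≠ 0`, `#Ш(E)[5^∞] = 25 = #Ш_an`, `BSD(E,5)`
at both pairs from PUBLISHED theorems + certificates. Hence ALL 615 rank-`0` X11-type census pairs
(`N < 2·10⁴`, `p ≥ 5`) are reached per pair (613 by Prop. 21 alone, 2 by visibility); the
CLASS-level residue (the très-ramifié `¬ram` lower bound, `X11RankZero.MissingInputAt`) is unchanged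
and stays typed — visibility is a per-curve certificate shape (it needs a congruent partner of larger
rank: Cremona–Mazur's "invisible" 2849a1, 4343b1, 5389a1 have none at their own level). No verdict or
label is changed by this addendum (the lane certifies; `b2b-bsdres-x11a/REPORT-g9.md`).

References: `b2b-bsdres-x11a/REPORT.md`; REFEREE.md C3, R6.3, R6.5, R6.7; Miller, LMS J. Comput.
Math. 14 (2011) §1 [Miller2011LMS]; Wuthrich 2014 Prop. 21 [Wuthrich2014]; Skinner 2016 Thm. C
[Skinner2016PacificMC]; Castella's erratum Thm. A′ [Castella2018Erratum]; Skinner–Zhang 2014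
[SkinnerZhang2014]; Burungale–Castella–Skinner 2025 [BurungaleCastellaSkinner2025]; Fouquet–Wan
arXiv:2107.13726 [FouquetWan2021]; Burungale–Skinner–Tian–Wan arXiv:2409.01350; Stein–Wuthrich 2013
Thm. 6.1, §4.2, Thm. 7.3 [SteinWuthrich2013]; Emerton–Pollack–Weston 2006 Cor. 5.1.4 / Thm. 5.1.3
[EmertonPollackWeston2006]; Cremona–Mazur, Exp. Math. 9 (2000); Agashe–Stein 2002 Thm. 3.1.
-/

noncomputable section

open scoped Classical

open WeierstrassCurve Literature.NumberTheory.EllipticCurves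
  Literature.NumberTheory.EllipticCurves.Rank1Residual
  Literature.NumberTheory.EllipticCurves.Wuthrich2014

namespace Literature.NumberTheory.EllipticCurves.Rank1Residual.Typed

/-! ### The typed inputs -/

/-- **MISSING INPUT (construction-shaped; NOT a cited fact; nothing in print or announced supplies
it).** The typed missing input of the rank-zero clause of X11 — `mult(p) ∧ irr(p) ∧ ¬ram(p) ∧
r = 0` — AT the pair `(E, p)`, any prime `p`: with `ρ̄_{E,p}` SURJECTIVE the upper bound
`ord_p #Ш ≤ ord_p #Ш_an` is Wuthrich, Doc. Math. 19 (2014) Prop. 21 (in print, `p` odd and not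
additive), so what is missing is the LOWER bound `ord_p #Ш(E/ℚ)_an ≤ ord_p #Ш(E/ℚ)`
(`MissingLowerBoundAt`: the Eisenstein-congruence direction — a (ram)-FREE integral cyclotomic IMC
at `p ‖ N`; Skinner 2016 Thm. C (ii), Skinner–Urban 2014 Thm. 3.6.4 (iii) and Kato Thm. 13.4 (3)
use the auxiliary ramified `q ‖ N`, Burungale–Castella–Skinner 2025 remove it only at good
ordinary `p`, Fouquet–Wan arXiv:2107.13726 Thm. 1.1 keeps (Steinberg) and excludes Steinberg-at-`p`
by (Langlands)); with an irreducible NON-surjective image it is the whole output `MissingPPartAt`.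
A predicate on `(W, p)`; nothing asserted. The instance `p = 3` is `X11ThreeRankZero.MissingInputAt`.
[cite: Wuthrich2014, Prop. 21 (p. 400) (shape only; nothing asserted)]
[cite: Miller2011LMS, Def. 1.1 (arXiv:1010.2431 p. 3) (shape only; nothing asserted)] -/
def X11RankZero.MissingInputAt (W : WeierstrassCurve ℚ) (p : ℕ) : Prop :=
  (W.HasSurjectiveModNGaloisRep p → MissingLowerBoundAt W p) ∧
    (¬ W.HasSurjectiveModNGaloisRep p → MissingPPartAt W p)

/-- **The Skinner–Zhang-shaped rank-one statement AT the pair `(E, p)`**: on the Skinner–Zhang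
locus (hypotheses (a)–(e) of arXiv:1407.1099v1 Thm. 1.1, `SkinnerZhang2014.Hypotheses W p`) the
print shape `PPart W p` (torsion term `0` under (c) = irr). For `p ≥ 5` and analytic rank one it is
supplied — CONDITIONALLY — by the unrefereed Thm. 1.2 (`X11.skinnerZhangShapeAt_of_OPEN`); the
companion of x11b's `X11.AprimeShapeAt`. A predicate on `(W, p)`; nothing asserted (shape only).
[claim: SkinnerZhang2014, status: under-review] -/
def X11.SkinnerZhangShapeAt (W : WeierstrassCurve ℚ) [W.IsElliptic] [W.IsGloballyMinimal] (p : ℕ)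
    [Fact p.Prime] : Prop :=
  SkinnerZhang2014.Hypotheses W p → PPart W p

/-- **MISSING INPUT (construction-shaped; NOT a cited fact).** The typed missing input of class X11
AT the pair `(E, p)`, both ranks: in analytic rank `0` the rank-zero input
(`X11RankZero.MissingInputAt`: the lower bound, resp. the whole output without surjectivity), in
analytic rank `1` the whole output `MissingPPartAt W p` (Miller's last clause: `#Ш_an` rational of
valuation `ord_p #Ш`). At `p ≥ 5` the rank-one component is supplied CONDITIONALLY by announced
binders on the A′-locus and on the Skinner–Zhang locus and by nothing elsewhere; the rank-zero
component by nothing anywhere (beyond the published sub-class `surj ∧ p ∤ #Ш_an`, where it is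
trivially true). At a pair with `p ∤ #Ш_an` (all 93 census pairs of X11 ∧ `p ≥ 5` below `10⁴`) it is
equivalent, for finite `Ш`, to the finite certificate `Ш(E/ℚ)[p] = 0`
(`Typed/KolyvaginCertificate.lean`, gen 3). A predicate on `(W, p)`; nothing asserted.
[cite: Miller2011LMS, Def. 1.1 (arXiv:1010.2431 p. 3) (shape only; nothing asserted)]
[cite: Wuthrich2014, Prop. 21 (p. 400) (shape only; nothing asserted)] -/
def X11.MissingInputAt (W : WeierstrassCurve ℚ) (p : ℕ) : Prop :=
  (W.analyticRank = 0 → X11RankZero.MissingInputAt W p) ∧ (W.analyticRank = 1 → MissingPPartAt W p)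

variable {W : WeierstrassCurve ℚ} {p : ℕ} [Fact p.Prime]

/-! ### Bookkeeping: consistency with the `p = 3` file and with the published sub-classes -/

omit [Fact p.Prime] in
/-- The `p = 3` instance of the rank-zero typed input is x11b's `X11ThreeRankZero.MissingInputAt`
(definitionally). [folklore] -/
theorem X11RankZero.missingInputAt_three_iff :
    X11RankZero.MissingInputAt W 3 ↔ X11ThreeRankZero.MissingInputAt W :=
  Iff.rfl

omit [Fact p.Prime] in
/-- On the PUBLISHED rank-zero sub-class (`ρ̄_{E,p}` surjective and `#Ш_an` a rational of `p`-adic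
valuation `0`; Wuthrich Prop. 21 closes it, `bsdp_of_classX11_rankZero_surj_of_shaAn_unit`) the
typed rank-zero input holds trivially: `0 ≤ ord_p #Ш`. So the typed input asks for nothing where
print already decides. [cite: Wuthrich2014, Prop. 21 (p. 400)] -/
theorem X11RankZero.missingInputAt_of_surj_of_shaAn_unit (hsurj : W.HasSurjectiveModNGaloisRep p)
    (hunit : ∃ q : ℚ, shaAn W = (q : ℂ) ∧ padicValRat p q = 0) :
    X11RankZero.MissingInputAt W p := by
  refine ⟨fun _ => ?_, fun h => absurd hsurj h⟩
  obtain ⟨q, hq, hv⟩ := hunit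
  exact ⟨q, hq, by rw [hv]; exact_mod_cast Nat.zero_le _⟩

omit [Fact p.Prime] in
/-- The whole output implies the rank-zero typed input (lower half, resp. itself). Bookkeeping.
[cite: Miller2011LMS, Def. 1.1] -/
theorem X11RankZero.missingInputAt_of_missingPPartAt (h : MissingPPartAt W p) :
    X11RankZero.MissingInputAt W p :=
  ⟨fun _ => (lower_and_upper_of_missingPPartAt W p h).1, fun _ => h⟩

/-- On the PUBLISHED finite sub-class `N_E < 5000` (Miller 2011 Thm. 1.2, binder
`bsdp_of_irreducible_of_conductor_lt`; `bsdp_of_classX11_of_conductor_lt`) the typed input of X11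
holds (from `BSD(E,p)` itself, `missingPPartAt_of_bsdp`; GZK `hGZK` for the finiteness of `Ш`).
[cite: Miller2011LMS, Thm. 1.2] -/
theorem X11.missingInputAt_of_conductor_lt [W.IsElliptic] [W.IsGloballyMinimal]
    (hM : bsdp_of_irreducible_of_conductor_lt)
    (hGZK : rank_eq_analyticRank_of_analyticRank_le_one) (hr : W.analyticRank ≤ 1)
    (hX : ClassX11 W p) (hN : W.conductorNorm ℤ < 5000) : X11.MissingInputAt W p := by
  haveI : Finite W.sha := (hGZK W hr).2
  have h : MissingPPartAt W p :=
    missingPPartAt_of_bsdp W p (bsdp_of_classX11_of_conductor_lt W p hM hr hX hN)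
  exact ⟨fun _ => X11RankZero.missingInputAt_of_missingPPartAt h, fun _ => h⟩

/-! ### What the ANNOUNCED binders supply at `p ≥ 5` (conditional; deletes nothing) -/

/-- **At `p ≥ 5` the Skinner–Zhang-shaped statement at a pair of analytic rank one is supplied —
CONDITIONALLY — by the announced binder** `SkinnerZhang2014.thm1_2_padicVal_bsd_rankOne_OPEN`
(arXiv:1407.1099v1 Thm. 1.2, unrefereed since 2014); `Ш` finite by Gross–Zagier–Kolyvagin (`hGZK`,
bsd.S17); torsion term killed by (c) (`pPart_of_noTorsionShape`). NOT a deletion of anything.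
[claim: SkinnerZhang2014, status: under-review] -/
theorem X11.skinnerZhangShapeAt_of_OPEN [W.IsElliptic] [W.IsGloballyMinimal]
    (hSZ : SkinnerZhang2014.thm1_2_padicVal_bsd_rankOne_OPEN)
    (hGZK : rank_eq_analyticRank_of_analyticRank_le_one) (hp : 5 ≤ p)
    (hr : W.analyticRank = 1) : X11.SkinnerZhangShapeAt W p := by
  intro hH
  obtain ⟨-, hfin⟩ := hGZK W (le_of_eq hr)
  exact pPart_of_noTorsionShape W p hH.irr (hSZ W p hp hH hr hfin)

/-- **Rank one, ON the Skinner–Zhang locus, `p ≥ 5`: the typed output `MissingPPartAt W p` is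
supplied conditionally by the announced binder** (via `X11.skinnerZhangShapeAt_of_OPEN` and the
currency bridge `missingPPartAt_of_pPart`; modularity `hmod` for `L'(E,1) ≠ 0`). NOT a deletion.
[claim: SkinnerZhang2014, status: under-review] -/
theorem X11.missingPPartAt_of_skinnerZhang_OPEN [W.IsElliptic] [W.IsGloballyMinimal]
    (hSZ : SkinnerZhang2014.thm1_2_padicVal_bsd_rankOne_OPEN)
    (hGZK : rank_eq_analyticRank_of_analyticRank_le_one) (hmod : hasEntireLFunction_rat)
    (hp : 5 ≤ p) (hr : W.analyticRank = 1) (hH : SkinnerZhang2014.Hypotheses W p) :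
    MissingPPartAt W p :=
  missingPPartAt_of_pPart W p hmod hGZK (le_of_eq hr)
    (X11.skinnerZhangShapeAt_of_OPEN hSZ hGZK hp hr hH)

/-- **Rank one, ON the A′-locus, `p ≥ 5`, multiplicative `p`, irreducible `E[p]`: the typed output
`MissingPPartAt W p` is supplied conditionally by the announced binder**
`Castella2018.erratum_thmAprime_padicVal_bsd_rankOne_OPEN` (web erratum, unrefereed, ⇐ Fouquet–Wan
arXiv:2107.13726 Thm. 4.41, unrefereed) — x11b's `X11.aprimeShapeAt_of_erratum_OPEN` composed with
`missingPPartAt_of_pPart`. NOT a deletion. [claim: Castella2018Erratum, status: under-review] -/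
theorem X11.missingPPartAt_of_aprimeLocusAt_OPEN [W.IsElliptic] [W.IsGloballyMinimal]
    (hA' : Castella2018.erratum_thmAprime_padicVal_bsd_rankOne_OPEN)
    (hGZK : rank_eq_analyticRank_of_analyticRank_le_one) (hmod : hasEntireLFunction_rat)
    (hp : 5 ≤ p) (hmult : W.HasMultiplicativeReductionAtPrime p)
    (hirr : W.HasIrreducibleModPGaloisRep p) (hr : W.analyticRank = 1)
    (hloc : X11.AprimeLocusAt W p) : MissingPPartAt W p :=
  missingPPartAt_of_pPart W p hmod hGZK (le_of_eq hr)
    (X11.aprimeShapeAt_of_erratum_OPEN hA' hGZK hp hmult hirr hr hloc)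

/-- **On `¬ram(p)` both announced loci are EMPTY** (the A′-locus needs a nonsplit ramified
multiplicative `q ≠ p`; Skinner–Zhang (e) gives a ramified multiplicative `ℓ ≠ p`): x11a's
`not_skinnerZhang_and_not_erratumAprime_of_not_ram` in the typed vocabulary. So on `X11 ∧ ¬ram(p)`
— both ranks — the typed inputs are supplied by nothing, published or announced. [folklore] -/
theorem X11.not_announcedLoci_of_not_ram [W.IsElliptic] [W.IsGloballyMinimal] (hX : ¬ Ram W p) :
    ¬ X11.AprimeLocusAt W p ∧ ¬ SkinnerZhang2014.Hypotheses W p :=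
  ⟨fun h => hX (X11.ram_of_aprimeLocusAt h), fun h => hX (ram_of_skinnerZhang_hypotheses h)⟩

/-! ### Conditional class theorems -/

/-- **X11, rank `0`, conditional class theorem (any odd `p`).** For `E/ℚ` (globally minimal `W`)
with `ord_{s=1} L(E,s) = 0` in class X11 at an odd prime `p` (multiplicative `p` ⇒ not additive),
the typed rank-zero input yields `BSD(E,p)`: with surjective `ρ̄_{E,p}` the published half is
Wuthrich 2014 Prop. 21 (`hW`, `bsdp_of_missingLowerBoundAt_of_wuthrich`; modularity `hmod` for
`r_an = 0 ⇒ L(E,1) ≠ 0`), otherwise the whole output is the hypothesis (`bsdp_of_missingPPartAt`);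
Gross–Zagier–Kolyvagin `hGZK`. Nothing in print or announced supplies `hmiss` on the class.
[cite: Wuthrich2014, Prop. 21 (p. 400)] [cite: Miller2011LMS, §1 and Def. 1.1] -/
theorem X11RankZero.bsdp_of_missingInputAt (hW : sha_dvd_analyticSha)
    (hGZK : rank_eq_analyticRank_of_analyticRank_le_one) (hmod : hasEntireLFunction_rat)
    (W : WeierstrassCurve ℚ) [W.IsElliptic] [W.IsGloballyMinimal] (p : ℕ) [Fact p.Prime]
    (hp : p ≠ 2) (hr : W.analyticRank = 0) (hX : ClassX11 W p)
    (hmiss : X11RankZero.MissingInputAt W p) : BSDp W p := by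
  by_cases hs : W.HasSurjectiveModNGaloisRep p
  · have hadd : ¬ ((W.baseChange ℚ_[p]).minimal ℤ_[p]).HasAdditiveReduction ℤ_[p] :=
      WeierstrassCurve.HasMultiplicativeReduction.not_hasAdditiveReduction (R := ℤ_[p]) hX.1
    exact bsdp_of_missingLowerBoundAt_of_wuthrich W p hW hGZK hmod hp hr hadd (Or.inr hs)
      (hmiss.1 hs)
  · exact bsdp_of_missingPPartAt W p hGZK (by omega) (hmiss.2 hs)

/-- **X11, both ranks, canonical conditional class theorem (any odd `p`):**
`r_an ≤ 1 → ClassX11 W p → X11.MissingInputAt W p → BSD(E,p)` (named facts: Wuthrich Prop. 21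
`hW`, GZK `hGZK`, modularity `hmod`). The typed input is the right TYPE: it closes the pair; it is
supplied in print only on the sub-classes of `Rank1Residual/X11.lean` and, at `p ≥ 5` in rank one,
by announced binders on two loci (`X11.bsdp_of_typedResidue_of_five_le`). NOT a deletion.
[cite: Miller2011LMS, §1 and Def. 1.1] [cite: Wuthrich2014, Prop. 21 (p. 400)] -/
theorem X11.bsdp_of_missingInputAt (hW : sha_dvd_analyticSha)
    (hGZK : rank_eq_analyticRank_of_analyticRank_le_one) (hmod : hasEntireLFunction_rat)
    (W : WeierstrassCurve ℚ) [W.IsElliptic] [W.IsGloballyMinimal] (p : ℕ) [Fact p.Prime]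
    (hp : p ≠ 2) (hr : W.analyticRank ≤ 1) (hX : ClassX11 W p) (hmiss : X11.MissingInputAt W p) :
    BSDp W p := by
  rcases Nat.le_one_iff_eq_zero_or_eq_one.mp hr with hr0 | hr1
  · exact X11RankZero.bsdp_of_missingInputAt hW hGZK hmod W p hp hr0 hX (hmiss.1 hr0)
  · exact bsdp_of_missingPPartAt W p hGZK hr (hmiss.2 hr1)

/-! ### The residue: exactly where an input is still needed -/

/-- **X11 at an odd `p`, residue after the PUBLISHED theorems only.** For `E/ℚ` (globally minimal
`W`) with `ord_{s=1} L(E,s) ≤ 1` in class X11 at an odd prime `p`, `BSD(E,p)` holds granted the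
published named facts (Miller 2011 `hM`, Wuthrich 2014 Prop. 21 `hW`, GZK `hGZK`, modularity
`hmod`) and the typed inputs ONLY where print does not decide: in rank `0` at `N_E ≥ 5000` outside
`surj(p) ∧ ord_p #Ш_an = 0`, in rank `1` at `N_E ≥ 5000`. No announced statement is used.
[cite: Miller2011LMS, Thm. 1.2 and Def. 1.1] [cite: Wuthrich2014, Prop. 21 (p. 400)] -/
theorem X11.bsdp_of_typedResidue (hM : bsdp_of_irreducible_of_conductor_lt)
    (hW : sha_dvd_analyticSha) (hGZK : rank_eq_analyticRank_of_analyticRank_le_one)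
    (hmod : hasEntireLFunction_rat)
    (W : WeierstrassCurve ℚ) [W.IsElliptic] [W.IsGloballyMinimal] (p : ℕ) [Fact p.Prime]
    (hp : p ≠ 2) (hr : W.analyticRank ≤ 1) (hX : ClassX11 W p)
    (h0 : W.analyticRank = 0 → 5000 ≤ W.conductorNorm ℤ →
      ¬ (W.HasSurjectiveModNGaloisRep p ∧ ∃ q : ℚ, shaAn W = (q : ℂ) ∧ padicValRat p q = 0) →
      X11RankZero.MissingInputAt W p)
    (h1 : W.analyticRank = 1 → 5000 ≤ W.conductorNorm ℤ → MissingPPartAt W p) : BSDp W p := by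
  by_cases hN : W.conductorNorm ℤ < 5000
  · exact bsdp_of_classX11_of_conductor_lt W p hM hr hX hN
  have hN' : 5000 ≤ W.conductorNorm ℤ := not_lt.mp hN
  rcases Nat.le_one_iff_eq_zero_or_eq_one.mp hr with hr0 | hr1
  · by_cases hsu : W.HasSurjectiveModNGaloisRep p ∧ ∃ q : ℚ, shaAn W = (q : ℂ) ∧ padicValRat p q = 0
    · have hL : W.entireLFunction 1 ≠ 0 := (W.analyticRank_eq_zero_iff_holds (hmod W)).1 hr0
      exact bsdp_of_classX11_rankZero_surj_of_shaAn_unit W p hW hGZK hp hX hL hsu.1 hsu.2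
    · exact X11RankZero.bsdp_of_missingInputAt hW hGZK hmod W p hp hr0 hX (h0 hr0 hN' hsu)
  · exact bsdp_of_missingPPartAt W p hGZK hr (h1 hr1 hN')

/-- **X11 at `p ≥ 5`, residue after the PUBLISHED theorems and the ANNOUNCED statements — the
kernel form of "what remains at `p ‖ N`".** For `E/ℚ` (globally minimal `W`) with
`ord_{s=1} L(E,s) ≤ 1` in class X11 at `p ≥ 5`, `BSD(E,p)` holds granted (i) the published named
facts (Miller `hM`, Wuthrich Prop. 21 `hW`, GZK `hGZK`, modularity `hmod`), (ii) the two ANNOUNCED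
rank-one binders, explicitly labelled OPEN (`hA'` Castella's erratum Thm. A′; `hSZ` Skinner–Zhang
Thm. 1.2) — which make the theorem CONDITIONAL and delete nothing — and (iii) the typed inputs
exactly on the remainder: rank `0` at `N_E ≥ 5000` outside `surj(p) ∧ ord_p #Ш_an = 0` (the
(ram)-free integral IMC direction); rank `1` at `N_E ≥ 5000` OFF the A′-locus AND OFF the
Skinner–Zhang locus (census `N < 10⁴`: 6240be1@5, 9954j1@7, 8670u1@5 — loci AS ANNOUNCED; under the
AS-PRINTED reading of REFEREE R8.1, flag `CAS18-ERR-ram2`, also 5824c1@7: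
`X11.bsdp_of_typedResidue_of_five_le_asPrinted`). On `¬ram(p)` clause (iii) is always the one invoked
(`X11.not_announcedLoci_of_not_ram`).
[cite: Miller2011LMS, Thm. 1.2 and Def. 1.1] [cite: Wuthrich2014, Prop. 21 (p. 400)]
[claim: Castella2018Erratum, status: under-review] [claim: SkinnerZhang2014, status: under-review] -/
theorem X11.bsdp_of_typedResidue_of_five_le (hM : bsdp_of_irreducible_of_conductor_lt)
    (hW : sha_dvd_analyticSha) (hGZK : rank_eq_analyticRank_of_analyticRank_le_one)
    (hmod : hasEntireLFunction_rat)
    (hA' : Castella2018.erratum_thmAprime_padicVal_bsd_rankOne_OPEN)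
    (hSZ : SkinnerZhang2014.thm1_2_padicVal_bsd_rankOne_OPEN)
    (W : WeierstrassCurve ℚ) [W.IsElliptic] [W.IsGloballyMinimal] (p : ℕ) [Fact p.Prime]
    (hp : 5 ≤ p) (hr : W.analyticRank ≤ 1) (hX : ClassX11 W p)
    (h0 : W.analyticRank = 0 → 5000 ≤ W.conductorNorm ℤ →
      ¬ (W.HasSurjectiveModNGaloisRep p ∧ ∃ q : ℚ, shaAn W = (q : ℂ) ∧ padicValRat p q = 0) →
      X11RankZero.MissingInputAt W p)
    (h1 : W.analyticRank = 1 → 5000 ≤ W.conductorNorm ℤ → ¬ X11.AprimeLocusAt W p →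
      ¬ SkinnerZhang2014.Hypotheses W p → MissingPPartAt W p) : BSDp W p := by
  have hp2 : p ≠ 2 := by omega
  refine X11.bsdp_of_typedResidue hM hW hGZK hmod W p hp2 hr hX h0 fun hr1 hN => ?_
  by_cases hloc : X11.AprimeLocusAt W p
  · exact X11.missingPPartAt_of_aprimeLocusAt_OPEN hA' hGZK hmod hp hX.mult hX.irr hr1 hloc
  by_cases hH : SkinnerZhang2014.Hypotheses W p
  · exact X11.missingPPartAt_of_skinnerZhang_OPEN hSZ hGZK hmod hp hr1 hH
  exact h1 hr1 hN hloc hH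

/-- **X11 ∧ `¬ram(p)`, both ranks, any odd `p`: the announced binders are idle.** On the first
disjunct of the class, `BSD(E,p)` follows from the published named facts and the typed inputs on the
remainder `N_E ≥ 5000 ∧ ¬(r = 0 ∧ surj(p) ∧ ord_p #Ш_an = 0)` — with NO `…_OPEN` hypothesis, because
neither announced locus meets `¬ram(p)`. This is the precise content of "X11 ∧ ¬ram is reached by
nothing at class level" (REFEREE C3): the missing published piece is a (ram)-free integral `p`-part
input at `p ‖ N`, typed here at the level of its output.
[cite: Miller2011LMS, Thm. 1.2 and Def. 1.1] [cite: Wuthrich2014, Prop. 21 (p. 400)] -/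
theorem X11.bsdp_of_not_ram_of_typedResidue (hM : bsdp_of_irreducible_of_conductor_lt)
    (hW : sha_dvd_analyticSha) (hGZK : rank_eq_analyticRank_of_analyticRank_le_one)
    (hmod : hasEntireLFunction_rat)
    (W : WeierstrassCurve ℚ) [W.IsElliptic] [W.IsGloballyMinimal] (p : ℕ) [Fact p.Prime]
    (hp : p ≠ 2) (hr : W.analyticRank ≤ 1) (hmult : Mult W p) (hirr : Irr W p) (hnr : ¬ Ram W p)
    (h0 : W.analyticRank = 0 → 5000 ≤ W.conductorNorm ℤ →
      ¬ (W.HasSurjectiveModNGaloisRep p ∧ ∃ q : ℚ, shaAn W = (q : ℂ) ∧ padicValRat p q = 0) →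
      X11RankZero.MissingInputAt W p)
    (h1 : W.analyticRank = 1 → 5000 ≤ W.conductorNorm ℤ → MissingPPartAt W p) : BSDp W p :=
  X11.bsdp_of_typedResidue hM hW hGZK hmod W p hp hr ⟨hmult, hirr, Or.inl hnr⟩ h0 h1

/-! ### The announced A′ argument read AS PRINTED at `p ≥ 5` (REFEREE R8.1, `CAS18-ERR-ram2`) -/

/-- **Rank one, ON the A′ ∧ (ram2) sub-locus, `p ≥ 5`, multiplicative `p`, irreducible `E[p]`: the
typed output `MissingPPartAt W p` is supplied conditionally by the announced binder** — the
restriction of `X11.missingPPartAt_of_aprimeLocusAt_OPEN` along x11b's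
`X11.aprimeLocusAt_of_aprimeRam2LocusAt`. The sub-locus (`X11.AprimeRam2LocusAt`,
`Typed/X11Three.lean`) is where the announced argument closes AS PRINTED (REFEREE R8.1: the
rank-`0` input for the twist `E^D` is Skinner 2016 Thm. C (ii), which needs a second ramified
multiplicative prime `ℓ ∉ {p, q}`); census `N < 10⁴`, X11 ∧ `r = 1` ∧ `p ≥ 5`: 7110m1@5 only.
NOT a deletion.
[claim: Castella2018Erratum, status: under-review] -/
theorem X11.missingPPartAt_of_aprimeRam2LocusAt_OPEN [W.IsElliptic] [W.IsGloballyMinimal]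
    (hA' : Castella2018.erratum_thmAprime_padicVal_bsd_rankOne_OPEN)
    (hGZK : rank_eq_analyticRank_of_analyticRank_le_one) (hmod : hasEntireLFunction_rat)
    (hp : 5 ≤ p) (hmult : W.HasMultiplicativeReductionAtPrime p)
    (hirr : W.HasIrreducibleModPGaloisRep p) (hr : W.analyticRank = 1)
    (hloc : X11.AprimeRam2LocusAt W p) : MissingPPartAt W p :=
  X11.missingPPartAt_of_aprimeLocusAt_OPEN hA' hGZK hmod hp hmult hirr hr
    (X11.aprimeLocusAt_of_aprimeRam2LocusAt hloc)

/-- **On the A′ ∧ (ram2) sub-locus Skinner–Zhang's hypothesis (e) holds** — two distinct primes of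
multiplicative reduction with `p ∤ v(Δ_min)`, namely the nonsplit `q` and the (ram2) prime `ℓ` — in
exactly the shape of the field `SkinnerZhang2014.Hypotheses.two_ramified`; so the two announced loci
meet there as soon as (b) and (d) of arXiv:1407.1099 Thm. 1.1 hold as well (census: 7110m1@5 lies
on both, module docstring). Bookkeeping; nothing asserted.
[cite: SkinnerZhang2014, Thm. 1.1 (e) (arXiv:1407.1099v1 p. 1) (shape only; nothing asserted)] -/
theorem X11.skinnerZhang_two_ramified_of_aprimeRam2LocusAt [W.IsGloballyMinimal]
    (h : X11.AprimeRam2LocusAt W p) :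
    ∃ (ℓ₁ ℓ₂ : ℕ) (_ : Fact ℓ₁.Prime) (_ : Fact ℓ₂.Prime), ℓ₁ ≠ ℓ₂ ∧
      W.HasMultiplicativeReductionAtPrime ℓ₁ ∧ W.HasMultiplicativeReductionAtPrime ℓ₂ ∧
      ¬ p ∣ padicValInt ℓ₁ W.minimalDiscriminantInt ∧
      ¬ p ∣ padicValInt ℓ₂ W.minimalDiscriminantInt := by
  obtain ⟨q, hq, ℓ, hℓ, -, -, hℓq, hmq, hvq, hmℓ, hvℓ⟩ :=
    X11.exists_two_ramified_of_aprimeRam2LocusAt h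
  exact ⟨q, ℓ, hq, hℓ, fun hql => hℓq hql.symm, hmq, hmℓ, hvq, hvℓ⟩

/-- **X11 at `p ≥ 5`, residue after the PUBLISHED theorems and the announced statements read AS
PRINTED (REFEREE R8.1).** As `X11.bsdp_of_typedResidue_of_five_le`, but the announced binder A′
(`hA'`) is invoked only on the A′ ∧ (ram2) sub-locus `X11.AprimeRam2LocusAt` (where Castella's
argument closes as printed) and Skinner–Zhang (`hSZ`) on its locus; the typed rank-one input is
then needed exactly at `N_E ≥ 5000` OFF the (ram2) sub-locus AND OFF the Skinner–Zhang locus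
(census `N < 10⁴`: 5824c1@7, 6240be1@5, 8670u1@5, 9954j1@7 — every open rank-one pair but
7110m1@5), the rank-zero input as before. CONDITIONAL on the two OPEN binders; deletes nothing;
on `¬ram(p)` the binders are idle (`X11.not_announcedLoci_of_not_ram`,
`X11.ram_of_aprimeRam2LocusAt`).
[cite: Miller2011LMS, Thm. 1.2 and Def. 1.1] [cite: Wuthrich2014, Prop. 21 (p. 400)]
[claim: Castella2018Erratum, status: under-review] [claim: SkinnerZhang2014, status: under-review] -/
theorem X11.bsdp_of_typedResidue_of_five_le_asPrinted (hM : bsdp_of_irreducible_of_conductor_lt)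
    (hW : sha_dvd_analyticSha) (hGZK : rank_eq_analyticRank_of_analyticRank_le_one)
    (hmod : hasEntireLFunction_rat)
    (hA' : Castella2018.erratum_thmAprime_padicVal_bsd_rankOne_OPEN)
    (hSZ : SkinnerZhang2014.thm1_2_padicVal_bsd_rankOne_OPEN)
    (W : WeierstrassCurve ℚ) [W.IsElliptic] [W.IsGloballyMinimal] (p : ℕ) [Fact p.Prime]
    (hp : 5 ≤ p) (hr : W.analyticRank ≤ 1) (hX : ClassX11 W p)
    (h0 : W.analyticRank = 0 → 5000 ≤ W.conductorNorm ℤ →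
      ¬ (W.HasSurjectiveModNGaloisRep p ∧ ∃ q : ℚ, shaAn W = (q : ℂ) ∧ padicValRat p q = 0) →
      X11RankZero.MissingInputAt W p)
    (h1 : W.analyticRank = 1 → 5000 ≤ W.conductorNorm ℤ → ¬ X11.AprimeRam2LocusAt W p →
      ¬ SkinnerZhang2014.Hypotheses W p → MissingPPartAt W p) : BSDp W p := by
  have hp2 : p ≠ 2 := by omega
  refine X11.bsdp_of_typedResidue hM hW hGZK hmod W p hp2 hr hX h0 fun hr1 hN => ?_
  by_cases hloc : X11.AprimeRam2LocusAt W p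
  · exact X11.missingPPartAt_of_aprimeRam2LocusAt_OPEN hA' hGZK hmod hp hX.mult hX.irr hr1 hloc
  by_cases hH : SkinnerZhang2014.Hypotheses W p
  · exact X11.missingPPartAt_of_skinnerZhang_OPEN hSZ hGZK hmod hp hr1 hH
  exact h1 hr1 hN hloc hH

end Literature.NumberTheory.EllipticCurves.Rank1Residual.Typed
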